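import Mathlib
import Literature.Analysis.FluidPDE.TaoAveragedSobolev
import Literature.Analysis.FluidPDE.TaoCascadeBlowupDynamicsHolds
import HarnessLib

/-!
# Tao 2016 — what is, and what is not, stable about the averaged-NS blow-up

HONEST FRAMING (FLUID COMPUTER cell `pub-fluidc`, verbatim): *low prior, high value-of-information
experiment on Tao's machine paradigm; NOT a claim that NS blows up.* This file is Literature
bookkeeping for the cell's spec question R11 ("what robustness radius may the Tao instance of the
gadget spec claim, and on what authority?"). It asserts nothing about the Navier–Stokes equations
and proves nothing new about Tao's cascade: every theorem below repackages the tree's Thm. 6.2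
(`TaoCascade.noGlobalODESolution_holds`) and the checkpoint bounds of Prop. 6.3
(`TaoCascade.BlowupCheckpoints`), or is algebra.

Source: T. Tao, *Finite time blowup for an averaged three-dimensional Navier–Stokes equation*,
J. Amer. Math. Soc. 29 (2016) 601–674, arXiv:1402.0290v3 [`Tao2016AveragedNS`]. Locators are
section / proposition / equation / footnote numbers in the arXiv-v3 numbering already used by
`TaoCascadeODE.lean` ((6.0)–(6.8)), `TaoCascadeBlowupDynamics.lean` ((6.9)–(6.40)) and
`TaoCascadeRescaled.lean` ((6.43)–(6.84)); footnotes are numbered by their order in the arXiv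
source (fn. 12 sits in §1.2, fn. 23–24 in §4 at (4.4)); no PDF page numbers are asserted (the held
text `paper:arxiv-1402.0290` is chunked TeX, `page_kind: chunk`).

The three layers of the R11 answer are kept strictly apart.

## A. What the paper CLAIMS — a named fact, proved neither in print nor here

§4, footnote 23, attached to the choice of data (4.4) `u₀ := ψ_{1,n₀}`: *"Our analysis is in fact
somewhat stable, and will also apply if `u₀` is a sufficiently small perturbation of `ψ_{1,n₀}` in
the `H¹⁰_df` norm, thus creating blowup for a non-empty open set of initial data in smooth
topologies, although this open set is rather small and is also quite far from the origin (due to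
the large nature of `n₀`). We leave the details of this modification to the interested reader."*
Supporting mentions: §1.2 ("construct a stable blowup solution to the averaged Euler equation";
fn. 12: any supercritical hyperdissipation could replace the Laplacian), §1.3 ("blowup for a very
specific type of initial data (and tiny perturbations thereof)"). `StableBlowupNear 𝒜 u₀ r` types
the claim (no global mild solution `[0,∞) → H¹⁰_df` from any divergence-free Schwartz datum in the
open `H¹⁰_df`-ball of radius `r` about `u₀`), `averagedNS_stableBlowup` is its existential closure
(some symmetric averaging with cancellation, some datum, some `r > 0`), and
`averagedNS_blowup_of_stableBlowup : averagedNS_stableBlowup → averagedNS_blowup` records that it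
strengthens Thm. 1.5 (`Tao2016.averagedNS_blowup`, PROVED in the tree as
`Tao2016.averagedNS_blowup_holds`). NO RADIUS is stated in print ("sufficiently small" is all there
is), the smallness is measured in `H¹⁰_df` at generation `n₀` (time `0`) about a datum of `H¹⁰`-size
`~ (1+ε₀)^{10 n₀}` ("quite far from the origin"), and no uniformity in the generation is asserted.

## B. What the printed induction CERTIFIES — robustness to envelope forcing (theorems)

Thm. 6.2 is stated for the DIFFERENTIAL INCLUSION (6.0)–(6.8): the equations of motion (6.1)–(6.4)
hold up to errors `O((1+ε₀)^{2n} E_n^{1/2})` (implied constant `C₁`), the energy identity is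
replaced by the one-sided local energy inequality (6.5), and `E_n` may exceed `½ Σ_i X_{i,n}²` by
a defect `O((1+ε₀)^{2n} ∫₀ᵗ E_n)` in (6.7) (implied constant `C₂`); the conclusion holds for ALL
`C₁, C₂ ≥ 0` provided `n₀ ≥ N₀(ε₀, K, ε, C₁, C₂)` (`noGlobalODESolution`, proved in the tree as
`noGlobalODESolution_holds`). `ForcedCascade … g D X E` re-presents a `TaoODESystem` as the EXACT
circuit (6.1)–(6.4) (`circuitField`) driven by an explicit forcing `g_{i,n}(t)` with an explicit
energy defect `D_n(t) ≥ 0`, and `InEnvelope ε₀ C₁ C₂ g D E` is the dissipation-size envelope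
`|g_{i,n}(t)| ≤ C₁ (1+ε₀)^{2n} E_n(t)^{1/2}`, `D_n(t) ≤ C₂ (1+ε₀)^{2n} ∫₀ᵗ E_n`.
`taoODESystem_iff_forced` is the (trivial) equivalence and `forcedCascade_noGlobal` is Thm. 6.2 in
this language: NO forcing inside the envelope — however adversarial (it need not come from a
dissipation, need not be autonomous or Markovian in the state; it is small only relative to
`√E_n` at the dissipation scale `(1+ε₀)^{2n}`) — admits a global solution of the forced cascade
with the exact data (6.6). This is the precise sense in which "our analysis is somewhat stable" is
CERTIFIED by print and tree. What is NOT certified is listed under D.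

## C. The SIZE of that robustness, generation by generation (§6.4)

In the rescaled variables of generation `N` (§6.4, (6.82)–(6.83) and the displays following them:
time unit `(1+ε₀)^{-5N/2} e_N^{-1}`, amplitude unit `e_N`) the envelope acquires the coefficient
`forcingRadius ε₀ C₁ N e_N = C₁ (1+ε₀)^{-N/2} e_N^{-1}` relative to the natural rate of the
generation-`N` circuit (`rescale_envelope`; Tao, proof of Prop. 6.4 from Prop. 6.5: *"If we
directly rescale (6.1)–(6.4), we obtain (6.45)–(6.48), except with the factors
`(1+ε₀)^{2k-n₀/2}` replaced by `(1+ε₀)^{2k-N/2} e_N^{-1}`"*). Under the checkpoint bounds of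
Prop. 6.3 (`BlowupCheckpoints`; the amplitude drift (6.11) gives `e_N^{-1} ≤ (1+ε₀)^{(N-n₀)/100}`)
this is at most `C₁ (1+ε₀)^{-n₀/2} (1+ε₀)^{-(49/100)(N-n₀)}` (`forcingRadius_le`): it DECAYS
geometrically along the cascade. Tao keeps only the generation-uniform upper bound
`C₁ (1+ε₀)^{-n₀/2}` (`forcingRadius_le_printed`), which is all the induction needs and which the
choice of `n₀` (last, after `ε₀, K, ε` and the implied constants, §6.1) makes as small as desired
(fn. 24: `(1+ε₀)^{-n₀/2}` plays the role of the viscosity). `envelope_le_forcingRadius_mul_rate`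
bounds the actual envelope on `[t_{n-1}, t_n]` by `(1+ε₀)^{1/100} · forcingRadius · rate` using the
energy bound (6.24). So the certified tolerance, measured relative to each generation's own
dynamics, is largest at generation `n₀` and shrinks by the factor `(1+ε₀)^{-49/100}` per
generation; a generation-UNIFORM relative robustness radius is neither stated nor proved in the
source (nor needed by it).

## D. What is NOT here (and not in print)

* No CHECKPOINT-KICK statement. The reading "Prop. 6.4 tolerates any mode-wise perturbation at a
  checkpoint `t_N` below the tolerances of Prop. 6.3 (viii)" is NOT a theorem of the paper or of
  the tree and is not asserted here: Prop. 6.5's hypotheses carry the exact vanishing (6.50) of all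
  modes above `n₀` at the initial time `τ_{n₀-N}` and the whole energy history (6.64)–(6.66), and
  the proof of Prop. 6.13 (§6.6, (6.120)–(6.125)) Gronwalls the next-level modes `b₁, c₁, d₁` from
  that exact zero through the crude past bound `Ẽ₁(t) ≲ K^{-30}/(1+|t|)³`; (viii) bounds
  `X_{1..4,N}(t_N)`, `E_{N-1}(t_N)` and (ix) the energies `E_{N+m}`, but is not a complete state
  description, and an instantaneous kick is not an operation `blowupDynamicsStep` (Prop. 6.4 as
  typed) quantifies over. Whether the induction survives such kicks is footnote 23's "details … left to the
  interested reader" — layer A, a named fact.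
* (6.5) is ONE-SIDED: along a `ForcedCascade`, `D_n′ + ∑ᵢ X_{i,n} g_{i,n} ≤ 0`
  (`ForcedCascade.derivWithin_defect_add_work_nonpos`, from the gate cancellation
  `sum_mul_circuitField`) — the forcing's work is paid for by the non-negative, initially zero
  defect, so energy-injecting forcing is outside the certified class; so is any perturbation of the
  data (6.6) or of the no-low-frequency condition (6.8), which enter EXACTLY.
* The `X₃`-channel coefficient of Prop. 6.3 (viii) is `10⁻⁵ e^{-K¹⁰}` as printed and
  `10⁻⁵ e^{-K¹⁰/2}` as corrected by the author (see `TaoCascadeRescaled.lean`,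
  `TaoCascadeBlowupDynamicsCorrected.lean`); nothing in this file depends on which.
* `circuitField`, `ForcedCascade`, `InEnvelope`, `forcingRadius` are OUR names and readings; only
  `TaoODESystem` (6.0)–(6.8), `BlowupCheckpoints` (6.9)–(6.25) and the quoted sentences are Tao's.

## Main declarations

* `StableBlowupNear`, `averagedNS_stableBlowup` (named fact), `StableBlowupNear.anti`,
  `StableBlowupNear.center`, `averagedNS_blowup_of_stableBlowup`, `averagedNS_stableBlowup_iff`.
* `circuitField`, `ForcedCascade`, `InEnvelope`, `ForcedCascade.taoODESystem`,
  `TaoCascade.TaoODESystem.exists_forcedCascade`, `taoODESystem_iff_forced`, `InEnvelope.mono`,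
  `TaoCascade.TaoODESystem.mono`, `forcedCascade_noGlobal`, `sum_mul_circuitField`,
  `ForcedCascade.derivWithin_defect_add_work_nonpos`.
* `forcingRadius`, `rescale_envelope`, `forcingRadius_le`, `forcingRadius_le_printed`,
  `envelope_le_forcingRadius_mul_rate`.

## References

* T. Tao, J. Amer. Math. Soc. 29 (2016) 601–674, arXiv:1402.0290v3: §1.2 (fn. 12), §1.3, §4 (4.4)
  fn. 23–24, §6.1 (order of choice of parameters), Thm. 6.2 (6.0)–(6.8), Prop. 6.3 (6.9)–(6.25),
  Prop. 6.4 (6.26)–(6.40), §6.4 Prop. 6.5 (6.43)–(6.81) and the rescaling (6.82)–(6.84), §6.6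
  Prop. 6.13 (6.120)–(6.125). [`Tao2016AveragedNS`]
-/

noncomputable section

open Set MeasureTheory
open scoped ENNReal SchwartzMap

namespace Literature.Analysis.FluidPDE.Tao2016AveragedNS

open Literature.Analysis.FluidPDE.TaoCascade (TaoODESystem BlowupCheckpoints noGlobalODESolution
  noGlobalODESolution_holds)


/-! ## Part A. The printed stability claim (§4, footnote 23 at (4.4)) as a named fact -/

section Claim

open Literature.Analysis.FluidPDE.Tao2016

/-- Local notation for physical space `ℝ³`. -/
local notation "ℝ³" => EuclideanSpace ℝ (Fin 3)

/-- **Blow-up for every divergence-free Schwartz datum in the `H¹⁰_df`-ball of radius `r` about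
`u₀`**, for the averaged equation driven by `𝒜`: no datum `v₀` with `‖v₀ - u₀‖_{H¹⁰} < r`
(`eFourierSobolevNorm 10`, the tree's `H¹⁰_df` norm) admits a global mild solution
`u : [0,∞) → H¹⁰_df` (`AveragingDatum.IsMildSolution`, (1.15)). For `r ≤ 0` the ball is empty and
the predicate is vacuous; the content is at `r > 0`. This is the shape of Tao's footnote-23 claim
(see `averagedNS_stableBlowup`). [cite: Tao2016AveragedNS, §4 footnote 23 at (4.4)] -/
def StableBlowupNear (𝒜 : AveragingDatum) (u₀ : 𝓢(ℝ³, ℝ³)) (r : ℝ) : Prop :=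
  ∀ v₀ : 𝓢(ℝ³, ℝ³), VectorCalculus.IsDivFree ⇑v₀ →
    FunctionSpaces.eFourierSobolevNorm 10 (schwartzL2 v₀ - schwartzL2 u₀) < ENNReal.ofReal r →
      ¬ ∃ u : ℝ → L2C, 𝒜.IsMildSolution (schwartzL2 v₀) (Ici 0) u

/-- **Tao's stability assertion for the averaged blow-up (a CLAIM of the paper, stated without
proof).** §4, footnote 23 (attached to the choice of data (4.4) `u₀ := ψ_{1,n₀}` in
arXiv:1402.0290v3): *"Our analysis is in fact somewhat stable, and will also apply if `u₀` is a
sufficiently small perturbation of `ψ_{1,n₀}` in the `H¹⁰_df` norm, thus creating blowup for a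
non-empty open set of initial data in smooth topologies, although this open set is rather small and
is also quite far from the origin (due to the large nature of `n₀`). We leave the details of this
modification to the interested reader."* (Cf. §1.2 "construct a stable blowup solution to the
averaged Euler equation"; §1.3 "blowup for a very specific type of initial data (and tiny
perturbations thereof)".) Typed: some symmetric averaged Euler bilinear operator with the
cancellation property admits a divergence-free Schwartz datum `u₀` and a radius `r > 0` with
`StableBlowupNear 𝒜 u₀ r`. STATUS: a named fact, NOT proved in print (the required modification of
the induction of §6 — replacing the exact initial vanishing (6.6)/(6.8) at scales `≠ n₀` by
smallness — is "left to the interested reader") and NOT proved in the tree; consumers take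
`(h : averagedNS_stableBlowup)`. It implies Theorem 1.5 (`averagedNS_blowup_of_stableBlowup`).
[cite: Tao2016AveragedNS, §4 footnote 23 at (4.4)] -/
def averagedNS_stableBlowup : Prop :=
  ∃ 𝒜 : AveragingDatum, 𝒜.IsSymmetric ∧ 𝒜.HasCancellation ∧
    ∃ u₀ : 𝓢(ℝ³, ℝ³), VectorCalculus.IsDivFree ⇑u₀ ∧ ∃ r : ℝ, 0 < r ∧ StableBlowupNear 𝒜 u₀ r

variable {𝒜 : AveragingDatum} {u₀ : 𝓢(ℝ³, ℝ³)} {r r' : ℝ}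

/-- Shrinking the radius preserves stable blow-up. [cite: Tao2016AveragedNS, §4 footnote 23 at (4.4)] -/
theorem StableBlowupNear.anti (h : StableBlowupNear 𝒜 u₀ r) (hr : r' ≤ r) :
    StableBlowupNear 𝒜 u₀ r' := fun v₀ hdiv hlt =>
  h v₀ hdiv (hlt.trans_le (ENNReal.ofReal_le_ofReal hr))

/-- The centre of a stable blow-up ball (positive radius) is itself a blow-up datum.
[cite: Tao2016AveragedNS, §4 footnote 23 at (4.4)] -/
theorem StableBlowupNear.center (h : StableBlowupNear 𝒜 u₀ r) (hr : 0 < r)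
    (hdiv : VectorCalculus.IsDivFree ⇑u₀) :
    ¬ ∃ u : ℝ → L2C, 𝒜.IsMildSolution (schwartzL2 u₀) (Ici 0) u :=
  h u₀ hdiv (by simpa [sub_self, eFourierSobolevNorm_zero] using ENNReal.ofReal_pos.mpr hr)

/-- **The stability claim implies Theorem 1.5** (`Tao2016.averagedNS_blowup`, in tree and proved
there as `averagedNS_blowup_holds`): take the centre of the ball.
[cite: Tao2016AveragedNS, §4 footnote 23 at (4.4); Thm. 1.5] -/
theorem averagedNS_blowup_of_stableBlowup (h : averagedNS_stableBlowup) : averagedNS_blowup := by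
  obtain ⟨𝒜, hsymm, hcanc, u₀, hdiv, r, hr, hst⟩ := h
  exact ⟨𝒜, hsymm, hcanc, u₀, hdiv, hst.center hr hdiv⟩

/-- Unfolding: the stability claim says some symmetric cancelling averaged equation has an OPEN
`H¹⁰_df`-ball of divergence-free Schwartz blow-up data. [cite: Tao2016AveragedNS, §4 footnote 23 at (4.4)] -/
theorem averagedNS_stableBlowup_iff :
    averagedNS_stableBlowup ↔
      ∃ 𝒜 : AveragingDatum, 𝒜.IsSymmetric ∧ 𝒜.HasCancellation ∧
        ∃ u₀ : 𝓢(ℝ³, ℝ³), VectorCalculus.IsDivFree ⇑u₀ ∧ ∃ r : ℝ, 0 < r ∧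
          ∀ v₀ : 𝓢(ℝ³, ℝ³), VectorCalculus.IsDivFree ⇑v₀ →
            FunctionSpaces.eFourierSobolevNorm 10 (schwartzL2 v₀ - schwartzL2 u₀) <
                ENNReal.ofReal r →
              ¬ ∃ u : ℝ → L2C, 𝒜.IsMildSolution (schwartzL2 v₀) (Ici 0) u :=
  Iff.rfl

end Claim

/-! ## Part B. The printed induction as a statement about a FORCED cascade -/

section Forced

variable {ε₀ K ε C₁ C₂ : ℝ} {n₀ : ℤ} {g : Fin 4 → ℤ → ℝ → ℝ} {D : ℤ → ℝ → ℝ}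
  {X : Fin 4 → ℤ → ℝ → ℝ} {E : ℤ → ℝ → ℝ}

/-- The quadratic vector field of Tao's level-`n` circuit, i.e. the MAIN TERMS of the equations of
motion (6.1)–(6.4) (pump `-ε⁻²cd`, `+ε⁻²ca`; amplifier `εa² / -εab`, `ε⁻¹K¹⁰bc / -ε⁻¹K¹⁰c²`; tiny
seed pump `ε²e^{-K¹⁰}`; conduit `+K d_{n-1}²` in, `-(1+ε₀)^{5/2}K d_n a_{n+1}` out), including the
time-scale factor `(1+ε₀)^{5n/2}`; modes `X 0..3 = X_{1..4,n} = (a,b,c,d)`.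
[cite: Tao2016AveragedNS, §6.1 (6.1)–(6.4)] -/
def circuitField (ε₀ K ε : ℝ) (X : Fin 4 → ℤ → ℝ → ℝ) (i : Fin 4) (n : ℤ) (t : ℝ) : ℝ :=
  (1 + ε₀) ^ ((5 : ℝ) * n / 2) *
    ![-(ε ^ 2)⁻¹ * X 2 n t * X 3 n t - ε * X 0 n t * X 1 n t -
          ε ^ 2 * Real.exp (-K ^ 10) * X 0 n t * X 2 n t + K * X 3 (n - 1) t ^ 2,
      ε * X 0 n t ^ 2 - ε⁻¹ * K ^ 10 * X 2 n t ^ 2,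
      ε ^ 2 * Real.exp (-K ^ 10) * X 0 n t ^ 2 + ε⁻¹ * K ^ 10 * X 1 n t * X 2 n t,
      (ε ^ 2)⁻¹ * X 2 n t * X 0 n t -
          (1 + ε₀) ^ ((5 : ℝ) / 2) * K * X 3 n t * X 0 (n + 1) t] i

/-- **Tao's cascade system (6.0)–(6.8) with the error terms made EXPLICIT**: the four mode equations
hold EXACTLY with forcing functions `g i n t` (`∂ₜ X_{i,n} = (main terms) + g_{i,n}`), and the
combined energy is EXACTLY `E_n = ½∑ᵢX_{i,n}² + D_n` with an explicit non-negative energy defect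
`D_n(t)` (the energy in shell `n` not carried by the four tracked modes); everything else — a priori
regularity (6.0), the one-sided energy inequality (6.5), the EXACT initial data (6.6) and the EXACT
vanishing (6.8) below scale `n₀` — is as in the tree's `TaoCascade.TaoODESystem`. In Tao's proof the
forcing is the dissipation `Δu` seen through the wavelet modes and `D_n` the dissipation-created
in-shell defect (Lemma 4.1 (4.10)–(4.12)); here `g` and `D` are ARBITRARY. No size constraint on
`g`, `D` is part of this structure — see `InEnvelope`. [cite: Tao2016AveragedNS, §6.1 (6.0)–(6.8)] -/
structure ForcedCascade (ε₀ K ε : ℝ) (n₀ : ℤ) (g : Fin 4 → ℤ → ℝ → ℝ) (D : ℤ → ℝ → ℝ)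
    (X : Fin 4 → ℤ → ℝ → ℝ) (E : ℤ → ℝ → ℝ) : Prop where
  /-- `X_{i,n}` is continuously differentiable on `[0,+∞)`. -/
  contDiffOn_X : ∀ i n, ContDiffOn ℝ 1 (X i n) (Ici 0)
  /-- `E_n` is continuously differentiable on `[0,+∞)`. -/
  contDiffOn_E : ∀ n, ContDiffOn ℝ 1 (E n) (Ici 0)
  /-- `E_n ≥ 0`. -/
  nonneg_E : ∀ n t, 0 ≤ t → 0 ≤ E n t
  /-- (6.0): a priori regularity of the coefficients on every `[0,T]`. -/
  apriori_X : ∀ T : ℝ, 0 < T → ∃ M : ℝ, ∀ t ∈ Icc 0 T, ∀ (i : Fin 4) (n : ℤ),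
    (1 + (1 + ε₀) ^ ((10 : ℝ) * n)) * |X i n t| ≤ M
  /-- (6.0′): a priori regularity of the energies on every `[0,T]`. -/
  apriori_E : ∀ T : ℝ, 0 < T → ∃ M : ℝ, ∀ t ∈ Icc 0 T, ∀ n : ℤ,
    (1 + (1 + ε₀) ^ ((10 : ℝ) * n)) * Real.sqrt (E n t) ≤ M
  /-- (6.1)–(6.4) EXACTLY, with explicit forcing `g_{i,n}(t)`. -/
  eq : ∀ i n t, 0 ≤ t → derivWithin (X i n) (Ici 0) t = circuitField ε₀ K ε X i n t + g i n t
  /-- (6.5): the local energy inequality (one-sided; no forcing may pump energy into a shell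
  except through the conduit fluxes). -/
  energy : ∀ n t, 0 ≤ t →
    derivWithin (E n) (Ici 0) t ≤
      (1 + ε₀) ^ ((5 : ℝ) * n / 2) * K * X 3 (n - 1) t ^ 2 * X 0 n t -
        (1 + ε₀) ^ ((5 : ℝ) * (n + 1) / 2) * K * X 3 n t ^ 2 * X 0 (n + 1) t
  /-- (6.6), energies: `E_n(0) = ½·1_{n = n₀}` — EXACT. -/
  init_E : ∀ n, E n 0 = if n = n₀ then 1 / 2 else 0
  /-- (6.6), coefficients: `X_{i,n}(0) = 1_{(i,n) = (1,n₀)}` — EXACT (the datum is pinned). -/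
  init_X : ∀ i n, X i n 0 = if i = 0 ∧ n = n₀ then 1 else 0
  /-- (6.7) EXACTLY: `E_n = ½∑ᵢ X_{i,n}² + D_n` with an explicit defect `D_n`. -/
  defect : ∀ n t, 0 ≤ t → E n t = (1 / 2) * ∑ i, X i n t ^ 2 + D n t
  /-- The defect is non-negative ((6.7), lower bound). -/
  defect_nonneg : ∀ n t, 0 ≤ t → 0 ≤ D n t
  /-- (6.8): no very low frequencies, energies — EXACT. -/
  noLow_E : ∀ n t, n < n₀ → 0 ≤ t → E n t = 0
  /-- (6.8): no very low frequencies, coefficients — EXACT. -/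
  noLow_X : ∀ i n t, n < n₀ → 0 ≤ t → X i n t = 0

/-- **The error envelope of (6.1)–(6.4), (6.7)** with implied constants `C₁, C₂`: the forcing is
bounded by `|g_{i,n}(t)| ≤ C₁ (1+ε₀)^{2n} E_n(t)^{1/2}` and the defect by
`D_n(t) ≤ C₂ (1+ε₀)^{2n} ∫₀ᵗ E_n` — Tao's `O((1+ε₀)^{2n} E_n^{1/2})` and
`O((1+ε₀)^{2n} ∫₀ᵗ E_n(t′) dt′)`. [cite: Tao2016AveragedNS, §6.1 (6.1)–(6.4), (6.7)] -/
def InEnvelope (ε₀ C₁ C₂ : ℝ) (g : Fin 4 → ℤ → ℝ → ℝ) (D : ℤ → ℝ → ℝ) (E : ℤ → ℝ → ℝ) : Prop :=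
  (∀ i n t, 0 ≤ t → |g i n t| ≤ C₁ * (1 + ε₀) ^ ((2 : ℝ) * n) * Real.sqrt (E n t)) ∧
    ∀ n t, 0 ≤ t → D n t ≤ C₂ * (1 + ε₀) ^ ((2 : ℝ) * n) * ∫ s in (0 : ℝ)..t, E n s

/-- The main term of (6.1) (pump/input mode `X_{1,n}`). [cite: Tao2016AveragedNS, §6.1 (6.1)] -/
@[simp] theorem circuitField_zero (n : ℤ) (t : ℝ) :
    circuitField ε₀ K ε X 0 n t = (1 + ε₀) ^ ((5 : ℝ) * n / 2) *
      (-(ε ^ 2)⁻¹ * X 2 n t * X 3 n t - ε * X 0 n t * X 1 n t -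
        ε ^ 2 * Real.exp (-K ^ 10) * X 0 n t * X 2 n t + K * X 3 (n - 1) t ^ 2) := by
  simp [circuitField]

/-- The main term of (6.2) (mode `X_{2,n}`). [cite: Tao2016AveragedNS, §6.1 (6.2)] -/
@[simp] theorem circuitField_one (n : ℤ) (t : ℝ) :
    circuitField ε₀ K ε X 1 n t = (1 + ε₀) ^ ((5 : ℝ) * n / 2) *
      (ε * X 0 n t ^ 2 - ε⁻¹ * K ^ 10 * X 2 n t ^ 2) := by
  simp [circuitField]

/-- The main term of (6.3) (mode `X_{3,n}`). [cite: Tao2016AveragedNS, §6.1 (6.3)] -/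
@[simp] theorem circuitField_two (n : ℤ) (t : ℝ) :
    circuitField ε₀ K ε X 2 n t = (1 + ε₀) ^ ((5 : ℝ) * n / 2) *
      (ε ^ 2 * Real.exp (-K ^ 10) * X 0 n t ^ 2 + ε⁻¹ * K ^ 10 * X 1 n t * X 2 n t) := by
  simp [circuitField]

/-- The main term of (6.4) (output mode `X_{4,n}`, feeding scale `n+1`). [cite: Tao2016AveragedNS, §6.1 (6.4)] -/
@[simp] theorem circuitField_three (n : ℤ) (t : ℝ) :
    circuitField ε₀ K ε X 3 n t = (1 + ε₀) ^ ((5 : ℝ) * n / 2) *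
      ((ε ^ 2)⁻¹ * X 2 n t * X 0 n t -
        (1 + ε₀) ^ ((5 : ℝ) / 2) * K * X 3 n t * X 0 (n + 1) t) := by
  simp [circuitField]

/-- **A forced cascade whose forcing and defect lie in the `(C₁, C₂)`-envelope obeys Tao's system
(6.0)–(6.8) with those implied constants.** [cite: Tao2016AveragedNS, §6.1 (6.0)–(6.8)] -/
theorem ForcedCascade.taoODESystem (h : ForcedCascade ε₀ K ε n₀ g D X E)
    (henv : InEnvelope ε₀ C₁ C₂ g D E) : TaoODESystem ε₀ K ε C₁ C₂ n₀ X E where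
  contDiffOn_X := h.contDiffOn_X
  contDiffOn_E := h.contDiffOn_E
  nonneg_E := h.nonneg_E
  apriori_X := h.apriori_X
  apriori_E := h.apriori_E
  eq1 n t ht := by
    have := henv.1 0 n t ht
    rw [h.eq 0 n t ht, circuitField_zero]; simpa using this
  eq2 n t ht := by
    have := henv.1 1 n t ht
    rw [h.eq 1 n t ht, circuitField_one]; simpa using this
  eq3 n t ht := by
    have := henv.1 2 n t ht
    rw [h.eq 2 n t ht, circuitField_two]; simpa using this
  eq4 n t ht := by
    have := henv.1 3 n t ht
    rw [h.eq 3 n t ht, circuitField_three]; simpa using this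
  energy := h.energy
  init_E := h.init_E
  init_X := h.init_X
  defect_lower n t ht := by
    rw [h.defect n t ht]; linarith [h.defect_nonneg n t ht]
  defect_upper n t ht := by
    rw [h.defect n t ht]; linarith [henv.2 n t ht]
  noLow_E := h.noLow_E
  noLow_X := h.noLow_X

/-- **Conversely, every solution of Tao's system (6.0)–(6.8) IS a forced cascade in the envelope**,
with forcing `g_{i,n} := ∂ₜX_{i,n} - (main terms)` and defect `D_n := E_n - ½∑X_{i,n}²`. So the
tree's `TaoODESystem ε₀ K ε C₁ C₂ n₀` is exactly "exactly-forced cascade + `(C₁,C₂)`-envelope".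
[cite: Tao2016AveragedNS, §6.1 (6.0)–(6.8)] -/
theorem _root_.Literature.Analysis.FluidPDE.TaoCascade.TaoODESystem.exists_forcedCascade
    (h : TaoODESystem ε₀ K ε C₁ C₂ n₀ X E) :
    ∃ (g : Fin 4 → ℤ → ℝ → ℝ) (D : ℤ → ℝ → ℝ),
      ForcedCascade ε₀ K ε n₀ g D X E ∧ InEnvelope ε₀ C₁ C₂ g D E := by
  refine ⟨fun i n t => derivWithin (X i n) (Ici 0) t - circuitField ε₀ K ε X i n t,
    fun n t => E n t - (1 / 2) * ∑ i, X i n t ^ 2, ?_, ?_, ?_⟩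
  · exact
      { contDiffOn_X := h.contDiffOn_X
        contDiffOn_E := h.contDiffOn_E
        nonneg_E := h.nonneg_E
        apriori_X := h.apriori_X
        apriori_E := h.apriori_E
        eq := fun i n t _ => by ring
        energy := h.energy
        init_E := h.init_E
        init_X := h.init_X
        defect := fun n t _ => by ring
        defect_nonneg := fun n t ht => by linarith [h.defect_lower n t ht]
        noLow_E := h.noLow_E
        noLow_X := h.noLow_X }
  · intro i n t ht
    fin_cases i
    · simpa using h.eq1 n t ht
    · simpa using h.eq2 n t ht
    · simpa using h.eq3 n t ht
    · simpa using h.eq4 n t ht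
  · intro n t ht
    linarith [h.defect_upper n t ht]

/-- `TaoODESystem` ⟺ forced cascade in the envelope. [cite: Tao2016AveragedNS, §6.1 (6.0)–(6.8)] -/
theorem taoODESystem_iff_forced :
    TaoODESystem ε₀ K ε C₁ C₂ n₀ X E ↔
      ∃ (g : Fin 4 → ℤ → ℝ → ℝ) (D : ℤ → ℝ → ℝ),
        ForcedCascade ε₀ K ε n₀ g D X E ∧ InEnvelope ε₀ C₁ C₂ g D E :=
  ⟨fun h => h.exists_forcedCascade, fun ⟨_, _, hF, henv⟩ => hF.taoODESystem henv⟩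

/-- The envelope is monotone in the implied constants (a larger allowance is a weaker demand).
[cite: Tao2016AveragedNS, §6.1 (6.1)–(6.4), (6.7)] -/
theorem InEnvelope.mono {C₁' C₂' : ℝ} (h : InEnvelope ε₀ C₁ C₂ g D E) (h₁ : C₁ ≤ C₁')
    (h₂ : C₂ ≤ C₂') (hε₀ : -1 < ε₀) (hE : ∀ n t, 0 ≤ t → 0 ≤ E n t) :
    InEnvelope ε₀ C₁' C₂' g D E := by
  have hb : 0 < 1 + ε₀ := by linarith
  refine ⟨fun i n t ht => (h.1 i n t ht).trans ?_, fun n t ht => (h.2 n t ht).trans ?_⟩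
  · have : 0 ≤ (1 + ε₀) ^ ((2 : ℝ) * n) * Real.sqrt (E n t) := by positivity
    nlinarith
  · have hI : 0 ≤ ∫ s in (0 : ℝ)..t, E n s :=
      intervalIntegral.integral_nonneg ht fun s hs => hE n s hs.1
    have : 0 ≤ (1 + ε₀) ^ ((2 : ℝ) * n) * ∫ s in (0 : ℝ)..t, E n s := by positivity
    nlinarith

/-- **`TaoODESystem` is monotone in the implied constants `C₁, C₂`.**
[cite: Tao2016AveragedNS, §6.1 (6.1)–(6.4), (6.7)] -/
theorem _root_.Literature.Analysis.FluidPDE.TaoCascade.TaoODESystem.mono {C₁' C₂' : ℝ}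
    (h : TaoODESystem ε₀ K ε C₁ C₂ n₀ X E) (h₁ : C₁ ≤ C₁') (h₂ : C₂ ≤ C₂') (hε₀ : -1 < ε₀) :
    TaoODESystem ε₀ K ε C₁' C₂' n₀ X E := by
  obtain ⟨g, D, hF, henv⟩ := h.exists_forcedCascade
  exact hF.taoODESystem (henv.mono h₁ h₂ hε₀ h.nonneg_E)

/-- **What the printed induction certifies (Thm. 6.2, in tree as
`TaoCascade.noGlobalODESolution_holds`): the cascade blow-up is ROBUST TO ARBITRARY FORCING IN THE
ENVELOPE.** For `0 < ε₀ < 1`, `K ≥ K₀(ε₀)`, `0 < ε ≤ e₀(ε₀,K)`, ANY envelope constants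
`C₁, C₂ ≥ 0` and `n₀ ≥ N₀(ε₀,K,ε,C₁,C₂)`: no exactly-forced cascade from the pinned datum
`X_{i,n}(0) = 1_{(i,n)=(1,n₀)}` whose forcing and defect stay in the `(C₁,C₂)`-envelope exists
globally with the a priori regularity (6.0) — whatever the forcing does inside the envelope
(adversarial included), the weighted norm `supₙ (1+(1+ε₀)^{10n})|X_{i,n}|` must become unbounded in
finite time. [cite: Tao2016AveragedNS, §6.1 Thm. 6.2] -/
theorem forcedCascade_noGlobal :
    ∀ ε₀ : ℝ, 0 < ε₀ → ε₀ < 1 →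
      ∃ K₀ : ℝ, ∀ K : ℝ, K₀ ≤ K → 0 < K →
        ∃ e₀ : ℝ, 0 < e₀ ∧ ∀ ε : ℝ, 0 < ε → ε ≤ e₀ →
          ∀ C₁ C₂ : ℝ, 0 ≤ C₁ → 0 ≤ C₂ →
            ∃ N₀ : ℤ, ∀ n₀ : ℤ, N₀ ≤ n₀ →
              ∀ (g : Fin 4 → ℤ → ℝ → ℝ) (D : ℤ → ℝ → ℝ) (X : Fin 4 → ℤ → ℝ → ℝ) (E : ℤ → ℝ → ℝ),
                ForcedCascade ε₀ K ε n₀ g D X E → InEnvelope ε₀ C₁ C₂ g D E → False := by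
  intro ε₀ hε₀ hε₀1
  obtain ⟨K₀, hK⟩ := noGlobalODESolution_holds ε₀ hε₀ hε₀1
  refine ⟨K₀, fun K hK₀ hKpos => ?_⟩
  obtain ⟨e₀, he₀, hε⟩ := hK K hK₀ hKpos
  refine ⟨e₀, he₀, fun ε hεpos hεle C₁ C₂ hC₁ hC₂ => ?_⟩
  obtain ⟨N₀, hN⟩ := hε ε hεpos hεle C₁ C₂ hC₁ hC₂
  exact ⟨N₀, fun n₀ hn₀ g D X E hF henv => hN n₀ hn₀ ⟨X, E, hF.taoODESystem henv⟩⟩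

/-- **The gates conserve the modal energy up to the conduit fluxes** (the cancellation behind
(6.5)): `∑ᵢ X_{i,n} · (main term of ∂ₜX_{i,n}) = In_n − Out_n` with
`In_n = (1+ε₀)^{5n/2} K X_{4,n-1}² X_{1,n}` (charging by the previous level's drain pump) and
`Out_n = (1+ε₀)^{5(n+1)/2} K X_{4,n}² X_{1,n+1}` (the drain into the next level); the pump, tiny
pump, amplifier and rotor terms cancel in pairs (§5 (g-cancel)). Needs `1 + ε₀ > 0` for
`(1+ε₀)^{5n/2}(1+ε₀)^{5/2} = (1+ε₀)^{5(n+1)/2}`. [cite: Tao2016AveragedNS, §6.1 (6.1)–(6.5); §5 cancellation] -/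
theorem sum_mul_circuitField (hε₀ : -1 < ε₀) (X : Fin 4 → ℤ → ℝ → ℝ) (n : ℤ) (t : ℝ) :
    ∑ i, X i n t * circuitField ε₀ K ε X i n t =
      (1 + ε₀) ^ ((5 : ℝ) * n / 2) * K * X 3 (n - 1) t ^ 2 * X 0 n t -
        (1 + ε₀) ^ ((5 : ℝ) * (n + 1) / 2) * K * X 3 n t ^ 2 * X 0 (n + 1) t := by
  have hq : (0 : ℝ) < 1 + ε₀ := by linarith
  have hsplit : (1 + ε₀) ^ ((5 : ℝ) * (n + 1) / 2) =
      (1 + ε₀) ^ ((5 : ℝ) * n / 2) * (1 + ε₀) ^ ((5 : ℝ) / 2) := by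
    rw [← Real.rpow_add hq]; congr 1; ring
  simp only [Fin.sum_univ_four, circuitField_zero, circuitField_one, circuitField_two,
    circuitField_three, hsplit]
  ring

/-- **(6.5) is one-sided — the forcing does no net work beyond the defect's decrease.** Along a
`ForcedCascade` (with `1 + ε₀ > 0`), `d/dt(½∑ᵢX_{i,n}²) = In_n − Out_n + ∑ᵢ X_{i,n} g_{i,n}`
(`sum_mul_circuitField`), so the energy inequality (6.5) for `E_n = ½∑ᵢX_{i,n}² + D_n` reads
`D_n′(t) + ∑ᵢ X_{i,n}(t) g_{i,n}(t) ≤ 0` (derivative within `[0,∞)`): whatever instantaneous work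
the forcing does on shell `n` is paid for by a decrease of the non-negative, initially vanishing
defect `D_n`. In particular forcing that injects net energy into a shell is OUTSIDE the class
`ForcedCascade` certifies against — the certified robustness (`forcedCascade_noGlobal`) is to
dissipation-like envelope forcing. [cite: Tao2016AveragedNS, §6.1 (6.5), (6.7)] -/
theorem ForcedCascade.derivWithin_defect_add_work_nonpos (h : ForcedCascade ε₀ K ε n₀ g D X E)
    (hε₀ : -1 < ε₀) (n : ℤ) {t : ℝ} (ht : 0 ≤ t) :
    derivWithin (D n) (Ici 0) t + ∑ i, X i n t * g i n t ≤ 0 := by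
  have ht' : t ∈ Ici (0 : ℝ) := ht
  have hS : UniqueDiffWithinAt ℝ (Ici (0 : ℝ)) t := uniqueDiffOn_Ici 0 t ht'
  have hXd : ∀ i, HasDerivWithinAt (X i n) (derivWithin (X i n) (Ici 0) t) (Ici 0) t := fun i =>
    (((h.contDiffOn_X i n).differentiableOn one_ne_zero) t ht').hasDerivWithinAt
  have hEd : HasDerivWithinAt (E n) (derivWithin (E n) (Ici 0) t) (Ici 0) t :=
    (((h.contDiffOn_E n).differentiableOn one_ne_zero) t ht').hasDerivWithinAt
  have hkin : HasDerivWithinAt (fun s => (1 / 2 : ℝ) * ∑ i, X i n s ^ 2)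
      ((1 / 2 : ℝ) * ∑ i, ((2 : ℕ) : ℝ) * X i n t ^ (2 - 1) * derivWithin (X i n) (Ici 0) t)
      (Ici 0) t :=
    (HasDerivWithinAt.fun_sum fun i _ => (hXd i).fun_pow 2).const_mul _
  have hDd : HasDerivWithinAt (D n)
      (derivWithin (E n) (Ici 0) t -
        (1 / 2 : ℝ) * ∑ i, ((2 : ℕ) : ℝ) * X i n t ^ (2 - 1) * derivWithin (X i n) (Ici 0) t)
      (Ici 0) t := by
    refine (hEd.sub hkin).congr_of_mem (fun s hs => ?_) ht'
    have := h.defect n s hs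
    simp only [Pi.sub_apply]
    linarith
  rw [hDd.derivWithin hS]
  have hsum : (1 / 2 : ℝ) * ∑ i, ((2 : ℕ) : ℝ) * X i n t ^ (2 - 1) * derivWithin (X i n) (Ici 0) t =
      ∑ i, X i n t * circuitField ε₀ K ε X i n t + ∑ i, X i n t * g i n t := by
    rw [← Finset.sum_add_distrib, Finset.mul_sum]
    refine Finset.sum_congr rfl fun i _ => ?_
    rw [h.eq i n t ht]; push_cast; ring
  rw [hsum, sum_mul_circuitField hε₀]
  have := h.energy n t ht
  linarith

end Forced

/-! ## Part C. The size of the certified robustness, generation by generation (§6.4) -/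

section Rescaled

open Literature.Analysis.FluidPDE.TaoCascade

variable {ε₀ K ε C₁ C₂ : ℝ} {n₀ N : ℤ} {X : Fin 4 → ℤ → ℝ → ℝ} {E : ℤ → ℝ → ℝ} {t e : ℤ → ℝ}

/-- **The forcing radius of generation `N`** (a READING of §6.4, proof of Prop. 6.4 from Prop. 6.5): the coefficient
`C₁ (1+ε₀)^{-N/2} e_N^{-1}` that the error envelope `C₁ (1+ε₀)^{2n} E_n^{1/2}` of (6.1)–(6.4)
acquires in the rescaled variables of generation `N` (§6.4, (6.82)–(6.83) and the unnumbered
displays following them (time unit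
`(1+ε₀)^{-5N/2} e_N^{-1}`, amplitude unit `e_N`): Tao, *"If we directly rescale (6.1)–(6.4), we
obtain (6.45)–(6.48), except with the factors `(1+ε₀)^{2k-n₀/2}` replaced by
`(1+ε₀)^{2k-N/2} e_N^{-1}`". It is the size, RELATIVE to the natural rate of the generation-`N`
circuit, of the arbitrary forcing the printed induction tolerates at that generation
(`rescale_envelope`). [cite: Tao2016AveragedNS, §6.4, proof of Prop. 6.4 from Prop. 6.5, after (6.84)] -/
def forcingRadius (ε₀ C₁ : ℝ) (N : ℤ) (a : ℝ) : ℝ :=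
  C₁ * (1 + ε₀) ^ (-(N : ℝ) / 2) / a

/-- **Rescaling identity (§6.4).** At scale `n = N + k`, with `E = e_N² · Ẽ` (rescaled energy `Ẽ`),
the envelope `C₁ (1+ε₀)^{2n} E^{1/2}` equals
`forcingRadius · (1+ε₀)^{2k} · [(1+ε₀)^{5N/2} e_N²] · Ẽ^{1/2}` — forcing radius × rescaled scale
factor × (rate unit of generation `N`) × rescaled energy: exactly Tao's factor
`(1+ε₀)^{2k-N/2} e_N^{-1}` in (6.45)–(6.48) before he bounds it. [cite: Tao2016AveragedNS, §6.4, proof of Prop. 6.4 from Prop. 6.5, after (6.84)] -/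
theorem rescale_envelope (hε₀ : -1 < ε₀) (C₁ : ℝ) (N k : ℤ) {a : ℝ} (ha : 0 < a) (Etil : ℝ) :
    C₁ * (1 + ε₀) ^ ((2 : ℝ) * ((N + k : ℤ) : ℝ)) * Real.sqrt (a ^ 2 * Etil) =
      forcingRadius ε₀ C₁ N a * (1 + ε₀) ^ ((2 : ℝ) * k) *
        ((1 + ε₀) ^ ((5 : ℝ) * N / 2) * a ^ 2) * Real.sqrt Etil := by
  have hq : (0 : ℝ) < 1 + ε₀ := by linarith
  have hsq : Real.sqrt (a ^ 2 * Etil) = a * Real.sqrt Etil := by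
    rw [Real.sqrt_mul (sq_nonneg a), Real.sqrt_sq ha.le]
  have hexp : (1 + ε₀) ^ ((2 : ℝ) * ((N + k : ℤ) : ℝ)) =
      (1 + ε₀) ^ (-(N : ℝ) / 2) * (1 + ε₀) ^ ((2 : ℝ) * k) * (1 + ε₀) ^ ((5 : ℝ) * N / 2) := by
    rw [← Real.rpow_add hq, ← Real.rpow_add hq]; congr 1; push_cast; ring
  rw [hsq, hexp, forcingRadius]
  field_simp

/-- **The forcing radius decays along the cascade** (the factor Tao discards after (6.84)): under the
checkpoint bounds (6.9)–(6.25) up to level `N` (`BlowupCheckpoints`, from Prop. 6.3), the amplitude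
drift `e_N ≥ (1+ε₀)^{-(N-n₀)/100}` gives
`forcingRadius N e_N ≤ C₁ (1+ε₀)^{-n₀/2} · (1+ε₀)^{-(49/100)(N-n₀)}`: relative to its own dynamics,
generation `N` is certified robust only against forcing of relative size
`C₁ ν · (1+ε₀)^{-0.49 (N-n₀)}`, `ν := (1+ε₀)^{-n₀/2}` (the quantity playing the role of the
viscosity, footnote 24) — NOT uniformly in the generation. [cite: Tao2016AveragedNS, §6.4, proof of Prop. 6.4 from Prop. 6.5, after (6.84)] -/
theorem forcingRadius_le (h : BlowupCheckpoints ε₀ K ε n₀ N X E t e) (hε₀ : 0 < ε₀) (hC₁ : 0 ≤ C₁)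
    {n : ℤ} (hn₀ : n₀ ≤ n) (hnN : n ≤ N) :
    forcingRadius ε₀ C₁ n (e n) ≤
      C₁ * (1 + ε₀) ^ (-(n₀ : ℝ) / 2) * (1 + ε₀) ^ (-(49 : ℝ) / 100 * ((n : ℝ) - n₀)) := by
  have hq : (0 : ℝ) < 1 + ε₀ := by linarith
  have hpos : 0 < e n := h.amp_pos hn₀ hnN
  have hamp : (1 + ε₀) ^ (-((n : ℝ) - n₀) / 100) ≤ e n := h.rpow_le_amp hε₀ hn₀ hnN
  have hexp : (1 + ε₀) ^ (-(n₀ : ℝ) / 2) * (1 + ε₀) ^ (-(49 : ℝ) / 100 * ((n : ℝ) - n₀)) *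
      (1 + ε₀) ^ (-((n : ℝ) - n₀) / 100) = (1 + ε₀) ^ (-(n : ℝ) / 2) := by
    rw [← Real.rpow_add hq, ← Real.rpow_add hq]; congr 1; ring
  rw [forcingRadius, div_le_iff₀ hpos]
  calc C₁ * (1 + ε₀) ^ (-(n : ℝ) / 2)
      = C₁ * (1 + ε₀) ^ (-(n₀ : ℝ) / 2) * (1 + ε₀) ^ (-(49 : ℝ) / 100 * ((n : ℝ) - n₀)) *
          (1 + ε₀) ^ (-((n : ℝ) - n₀) / 100) := by rw [← hexp]; ring
    _ ≤ C₁ * (1 + ε₀) ^ (-(n₀ : ℝ) / 2) * (1 + ε₀) ^ (-(49 : ℝ) / 100 * ((n : ℝ) - n₀)) *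
          e n := by gcongr

/-- **Tao's printed bound (after (6.84)): `(1+ε₀)^{2k-N/2} e_N^{-1} ≤ (1+ε₀)^{2k-n₀/2}`,** i.e.
`forcingRadius N e_N ≤ C₁ (1+ε₀)^{-n₀/2}` uniformly in the generation — the coefficient
`(1+ε₀)^{-n₀/2}` of the error terms in (6.45)–(6.48) of Prop. 6.5. [cite: Tao2016AveragedNS, §6.4, proof of Prop. 6.4 from Prop. 6.5, after (6.84)] -/
theorem forcingRadius_le_printed (h : BlowupCheckpoints ε₀ K ε n₀ N X E t e) (hε₀ : 0 < ε₀)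
    (hC₁ : 0 ≤ C₁) {n : ℤ} (hn₀ : n₀ ≤ n) (hnN : n ≤ N) :
    forcingRadius ε₀ C₁ n (e n) ≤ C₁ * (1 + ε₀) ^ (-(n₀ : ℝ) / 2) := by
  have hq : (1 : ℝ) ≤ 1 + ε₀ := by linarith
  have hle : (1 + ε₀) ^ (-(49 : ℝ) / 100 * ((n : ℝ) - n₀)) ≤ 1 := by
    apply Real.rpow_le_one_of_one_le_of_nonpos hq
    have : (n₀ : ℝ) ≤ n := by exact_mod_cast hn₀
    nlinarith
  have h0 : 0 ≤ C₁ * (1 + ε₀) ^ (-(n₀ : ℝ) / 2) := by positivity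
  calc forcingRadius ε₀ C₁ n (e n)
      ≤ C₁ * (1 + ε₀) ^ (-(n₀ : ℝ) / 2) * (1 + ε₀) ^ (-(49 : ℝ) / 100 * ((n : ℝ) - n₀)) :=
        forcingRadius_le h hε₀ hC₁ hn₀ hnN
    _ ≤ C₁ * (1 + ε₀) ^ (-(n₀ : ℝ) / 2) * 1 := by gcongr
    _ = C₁ * (1 + ε₀) ^ (-(n₀ : ℝ) / 2) := by ring

/-- **The envelope inside one step, in that step's units.** During the step into level `n`
(`t_{n-1} ≤ τ ≤ t_n`, `n₀ < n ≤ N`) the energy estimate (6.24) `E_{n-1} + E_n ≤ e_{n-1}²` and the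
amplitude stability (6.11) bound the level-`n` envelope by
`C₁ (1+ε₀)^{2n} E_n(τ)^{1/2} ≤ (1+ε₀)^{1/100} · forcingRadius n e_n · [(1+ε₀)^{5n/2} e_n²]`:
at most `(1+ε₀)^{1/100} × forcing radius` times the natural rate of the level-`n` circuit.
[cite: Tao2016AveragedNS, §6.2 Prop. 6.3 (6.11), (6.24); §6.4 after (6.84)] -/
theorem envelope_le_forcingRadius_mul_rate (hsol : TaoODESystem ε₀ K ε C₁ C₂ n₀ X E)
    (h : BlowupCheckpoints ε₀ K ε n₀ N X E t e) (hε₀ : 0 < ε₀) (hC₁ : 0 ≤ C₁) {n : ℤ}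
    (hn₀ : n₀ < n) (hnN : n ≤ N) {τ : ℝ} (hτ : τ ∈ Icc (t (n - 1)) (t n)) :
    C₁ * (1 + ε₀) ^ ((2 : ℝ) * n) * Real.sqrt (E n τ) ≤
      (1 + ε₀) ^ ((1 : ℝ) / 100) * forcingRadius ε₀ C₁ n (e n) *
        ((1 + ε₀) ^ ((5 : ℝ) * n / 2) * e n ^ 2) := by
  have hq : (0 : ℝ) < 1 + ε₀ := by linarith
  have hs := h.step n hn₀ hnN
  have hpos : 0 < e n := h.amp_pos hn₀.le hnN
  have hpos' : 0 < e (n - 1) := h.amp_pos (by omega) (by omega)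
  have hτ0 : 0 ≤ τ := (h.time_le hε₀ (n := n - 1) (by omega) (by omega)).1.trans hτ.1
  have hEn : E n τ ≤ e (n - 1) ^ 2 := by
    have := hs.en_during τ hτ
    linarith [hsol.nonneg_E (n - 1) τ hτ0]
  have hsqrt : Real.sqrt (E n τ) ≤ e (n - 1) :=
    Real.sqrt_le_iff.mpr ⟨hpos'.le, hEn⟩
  have hprev : e (n - 1) ≤ (1 + ε₀) ^ ((1 : ℝ) / 100) * e n := by
    have h1 : (1 + ε₀) ^ ((1 : ℝ) / 100) * ((1 + ε₀) ^ (-(1 : ℝ) / 100) * e (n - 1)) ≤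
        (1 + ε₀) ^ ((1 : ℝ) / 100) * e n :=
      mul_le_mul_of_nonneg_left hs.amp_ge (Real.rpow_nonneg hq.le _)
    have h2 : (1 + ε₀) ^ ((1 : ℝ) / 100) * (1 + ε₀) ^ (-(1 : ℝ) / 100) = 1 := by
      rw [← Real.rpow_add hq]; norm_num
    calc e (n - 1) = (1 + ε₀) ^ ((1 : ℝ) / 100) * (1 + ε₀) ^ (-(1 : ℝ) / 100) * e (n - 1) := by
          rw [h2, one_mul]
      _ ≤ (1 + ε₀) ^ ((1 : ℝ) / 100) * e n := by rw [mul_assoc]; exact h1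
  have hexp : (1 + ε₀) ^ (-(n : ℝ) / 2) * (1 + ε₀) ^ ((5 : ℝ) * n / 2) =
      (1 + ε₀) ^ ((2 : ℝ) * n) := by
    rw [← Real.rpow_add hq]; congr 1; ring
  have hrhs : (1 + ε₀) ^ ((1 : ℝ) / 100) * forcingRadius ε₀ C₁ n (e n) *
      ((1 + ε₀) ^ ((5 : ℝ) * n / 2) * e n ^ 2) =
        C₁ * (1 + ε₀) ^ ((2 : ℝ) * n) * ((1 + ε₀) ^ ((1 : ℝ) / 100) * e n) := by
    rw [forcingRadius, ← hexp]; field_simp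
  rw [hrhs]
  have h0 : 0 ≤ C₁ * (1 + ε₀) ^ ((2 : ℝ) * n) := by positivity
  calc C₁ * (1 + ε₀) ^ ((2 : ℝ) * n) * Real.sqrt (E n τ)
      ≤ C₁ * (1 + ε₀) ^ ((2 : ℝ) * n) * e (n - 1) := by gcongr
    _ ≤ C₁ * (1 + ε₀) ^ ((2 : ℝ) * n) * ((1 + ε₀) ^ ((1 : ℝ) / 100) * e n) := by gcongr

end Rescaled

end Literature.Analysis.FluidPDE.Tao2016AveragedNS
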